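import Literature.IUT.LogThetaLattice.GlobalFrobenioidModelsPlacesHyps
import HarnessLib

/-!
# [IUTchIII] Example 3.6 (i): the standing-hypothesis bundle `ModelHyps` — universal closure AS TYPED is
# false; the instance of record is the number-field model `modelHyps_places`

S. Mochizuki, *Inter-universal Teichmüller theory III*, kurims manuscript (May 2020), §3, Example 3.6 (i)
p. 107 (the global realified / `⊩`-Frobenioids attached to `F_mod`, local value groups
`Γ_v = K_v^×/𝒪^×_{K_v}` with their nonnegative cones) [cite: Mochizuki2012, IUTchIII Ex. 3.6 (i) p. 107].
Claim key `Mochizuki2012`, status DISPUTED (D-0012); this PROOF-ONLY companion (no definitions) of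
`GlobalFrobenioidModelsCategory.lean` (seat abc-iut-L6-t6) asserts nothing of the series and takes no side
on [IUTchIII] Cor. 3.12.

FACT-LIST row **F-2610** (cell abc-iut, block F, seat abc-iut-f-045).  `GlobalFrobenioidModels.ModelHyps
nonneg β` is a HYPOTHESIS STRUCTURE on abstract data (`directed`, `saturated`, `sharp`, `finite`) over an
arbitrary field `F`, index type `V`, value groups `Γ_v ⊇ Γ_v^{≥0}` and valuations `β_v`; consumers take
`(H : ModelHyps nonneg β)` BY NAME.  Its universal closure over all data is FALSE (take the whole group as
the "nonnegative cone": sharpness fails at `1 ∈ ℤ`), while the instance the cone consumes — the places of a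
number field, `Γ_v = ℝ ⊇ ℝ_{≥0}`, `β_v = −log‖·‖_v` — is PROVED: `GlobalFrobenioidModels.modelHyps_places`
(abc-iut-w4-d005, `GlobalFrobenioidModelsPlacesHyps.lean`).  So the row is admissible AT NAMED INSTANCES ONLY
(R5); kernel object below.  A FACT row is an assumption label, not an endorsement.
-/

namespace Literature.IUT.LogThetaLattice.GlobalFrobenioidModels

/-- **F-2610, universal closure REFUTED.**  With `F = ℚ`, one index, `Γ = ℤ`, the cone `Γ^{≥0} := ⊤` (all
of `ℤ`) and `β = 0`, the clause `sharp` of `ModelHyps` fails: `1` and `−1` are both "nonnegative" but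
`1 ≠ 0`.  Instance form of record: `modelHyps_places` (number fields). [claim: Mochizuki2012, status: disputed]
[cite: Mochizuki2012, IUTchIII Ex. 3.6 (i) p. 107] -/
theorem not_forall_modelHyps :
    ¬ ∀ {F : Type} [Field F] {V : Type} {Γ : V → Type} [∀ v, AddCommGroup (Γ v)]
        (nonneg : ∀ v, AddSubmonoid (Γ v)) (β : ∀ v, Additive Fˣ →+ Γ v), ModelHyps nonneg β := by
  intro h
  have H : ModelHyps (F := ℚ) (V := Unit) (Γ := fun _ => ℤ) (fun _ => ⊤) (fun _ => 0) := h _ _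
  exact one_ne_zero (H.sharp () 1 trivial trivial)

/-- The instance of record, restated as an `example` (nothing new): the hypotheses HOLD at the places of a
number field. [claim: Mochizuki2012, status: disputed] [cite: Mochizuki2012, IUTchIII Ex. 3.6 (i) p. 107] -/
example {F : Type} [Field F] [NumberField F] :
    ModelHyps (F := F) (V := ModelPlaces F) (Γ := fun _ => ℝ) nonnegModel betaModel :=
  modelHyps_places F

end Literature.IUT.LogThetaLattice.GlobalFrobenioidModels
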